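import Literature.Computability.AlgebraicComplexity.Kron444VertexCertificates
import HarnessLib

/-!
# Occurrence certificates for `Kron(4,4,4)`: kernel evaluations, part 1/3

Proofs file (computations only): structural checks and dynamic-programme values of the
certificates cert1, cert2, cert3, cert4, cert5, cert6 of `Kron444VertexCertificates.lean`, decided by the kernel
(`decide +kernel`); the evaluator and its soundness are `HighestWeightPairingCertificates.lean`.
[folklore]
-/

set_option Elab.async false

namespace Literature.Computability.AlgebraicComplexity.PairingDP

/-- The structural checks of `cert1` pass. [folklore] -/
theorem cert1_check : cert1.check = true := by decide +kernel

/-- The dynamic programme of `cert1` evaluates to `24` (`128` transitions). [folklore] -/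
theorem cert1_value : cert1.dpValue = 24 := by
  set_option maxHeartbeats 0 in decide +kernel

/-- The structural checks of `cert2` pass. [folklore] -/
theorem cert2_check : cert2.check = true := by decide +kernel

/-- The dynamic programme of `cert2` evaluates to `48` (`589` transitions). [folklore] -/
theorem cert2_value : cert2.dpValue = 48 := by
  set_option maxHeartbeats 0 in decide +kernel

/-- The structural checks of `cert3` pass. [folklore] -/
theorem cert3_check : cert3.check = true := by decide +kernel

/-- The dynamic programme of `cert3` evaluates to `-40` (`80` transitions). [folklore] -/
theorem cert3_value : cert3.dpValue = -40 := by
  set_option maxHeartbeats 0 in decide +kernel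

/-- The structural checks of `cert4` pass. [folklore] -/
theorem cert4_check : cert4.check = true := by decide +kernel

/-- The dynamic programme of `cert4` evaluates to `96` (`32` transitions). [folklore] -/
theorem cert4_value : cert4.dpValue = 96 := by
  set_option maxHeartbeats 0 in decide +kernel

/-- The structural checks of `cert5` pass. [folklore] -/
theorem cert5_check : cert5.check = true := by decide +kernel

/-- The dynamic programme of `cert5` evaluates to `-1572864` (`6526` transitions). [folklore] -/
theorem cert5_value : cert5.dpValue = -1572864 := by
  set_option maxHeartbeats 0 in decide +kernel

/-- The structural checks of `cert6` pass. [folklore] -/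
theorem cert6_check : cert6.check = true := by decide +kernel

/-- The dynamic programme of `cert6` evaluates to `5184` (`510` transitions). [folklore] -/
theorem cert6_value : cert6.dpValue = 5184 := by
  set_option maxHeartbeats 0 in decide +kernel

end Literature.Computability.AlgebraicComplexity.PairingDP
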